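import Summits.BirchSwinnertonDyer.Rank1Residual.Additive.LocalTowerKernelAtPTwistedOrdinaryClasses
import Summits.BirchSwinnertonDyer.Rank1Residual.Additive.GordRankZeroChiBranch
import Literature.NumberTheory.EllipticCurves.QuadraticTwistPadicReduction
import HarnessLib

/-!
# T-T3B on the `e = 2` rows: the minimal model of the `p*`-twist as a good model, and
# `W.localTowerKerPrimary κ ℚ_v 0 = ⊥` on ALL of X4♯(G-ord) / X3♯(G-ord) at every odd `p`
# (team n1011, row T-T3B; seat p12 GEN 8; file F7)

HONEST FRAMING (cell `b2b-bsdres`, run/shared/lean/b2b/bsd-rank1-residual/, verbatim in every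
file): the goal of the cell is to DELETE the COMBINATION-SHAPED residual classes of the
Birch–Swinnerton-Dyer formula for ALL analytic-rank `≤ 1` elliptic curves over `ℚ` — "full BSD
formula for every rank `≤ 1` curve in class `C`" assembled STRICTLY from published theorems — so
that the rank-`≤ 1` remainder becomes exactly the CONSTRUCTION-SHAPED classes, which are TYPED
(missing-input `Prop`s), NOT attempted. This is not "finishing BSD". Team n1011 (N10/N11; row
T-T3B, skeleton `cells/n1011/skel/T-T3B.md`): research routes on CONSTRUCTION-SHAPED classes;
prove what is provable now; no claim beyond stated classes; census output = EVIDENCE, never a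
Literature fact; RESIDUAL-MAP marks UNCHANGED; nothing is booked by this file. TOOL THEOREMS ONLY:
no definition, no named fact, nothing cited enters as a hypothesis. Closes no pair by itself.

## What

On the additive potentially good ordinary rows with semistability defect `e_E(p) = 2` (Kodaira
`I₀*`; at `p = 3` every (G)-row), `E = W` is `C • V^{(p*)}` for a globally minimal `V/ℚ` with GOOD
ORDINARY reduction at `p` (tree `ClassX4Gord.exists_goodOrd_pStar_twist_model`, p10/p16). Over
`K̄_v ∋ √p*` the twist is a change of variables (`exists_variableChange_smul_eq_quadraticTwist_sq`),
so the MINIMAL MODEL of `V`, base-changed to the valuation ring of the spectral valuation of `K̄_v`,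
is a GOOD MODEL of `E` in p05's F-A2 currency (`exists_goodModel_and_ordinaryPoint_of_goodOrd_twist`:
`C' • (W ⊗ ℚ_v) ⊗ K̄_v = W₀ ⊗ K̄_v`, `Δ(W₀) ∈ 𝒪^×`), WITH an ordinary point (the tree's
`exists_zsmul_eq_zero_localRed_ne_zero` for `V`: `p ∤ a_p(V)`). Hence the row's END applies:

* `localTowerKerPrimary_zero_eq_bot_of_goodOrd_twist` — `W = C • V^{(d)}`, `V` good ordinary at
  `p`, `W` additive at `v ∋ p`, `p` odd, ANY `ℤ_p`-extension `κ`: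
  `W.localTowerKerPrimary κ (v.adicCompletion ℚ) 0 = ⊥`;
* `ClassX4Gord.localTowerKerPrimary_zero_eq_bot_of_semistabilityIndex_eq_two`,
  `ClassX3Gord.…` (`p` odd, `e = 2`);
* **`ClassX4Gord.localTowerKerPrimary_zero_eq_bot`**, **`ClassX3Gord.localTowerKerPrimary_zero_eq_bot`**
  — EVERY odd `p`, NO defect binder: `p = 3` ⟹ `e = 2` (additive-p2
  `semistabilityIndex_eq_two_of_typeG_three`); `p ≥ 5` by cases `e = 2` (this file) /
  `e ∈ {3,4,6}` (F6 `…_of_five_le_of_semistabilityIndex_ne_two`).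

This completes the `v ∣ p` socket `hp0 κ v` of p06's T-T3CTL ENDs on ALL X4♯(G-ord) / X3♯(G-ord)
pairs. NOT covered: the potentially multiplicative rows (Tate curve), `p = 2`.

References: [GreenbergLNM1716] R. Greenberg, LNM 1716 (1999), §3 Lemma 3.4 (p. 89), Prop. 3.8
(p. 95); [SilvermanAEC2009] J. H. Silverman, *AEC*, X.5 Cor. 5.4, VII.5.5, V.3.1(a), VII.2.1;
cells/n1011/skel/T-T3B.md.
-/

noncomputable section

open scoped Classical NNReal NumberField

open WeierstrassCurve

universe u

namespace Summit.BirchSwinnertonDyer.Rank1Residual.Additive.GoodModelLine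

open NumberField IsDedekindDomain Field IsDedekindDomain.HeightOneSpectrum
  Literature.NumberTheory.GaloisRepresentations
  Literature.NumberTheory.EllipticCurves
  Literature.NumberTheory.EllipticCurves.GreenbergSelmer
  Literature.NumberTheory.EllipticCurves.EmertonPollackWeston2006
  Literature.NumberTheory.EllipticCurves.Rank1Residual
  Literature.NumberTheory.EllipticCurves.Rank1Residual.Typed
  Summit.BirchSwinnertonDyer.Rank1Residual.X2.GreenbergVatsalReductionDatum
  Summit.BirchSwinnertonDyer.Rank1Residual.X2.GreenbergVatsalTateDatumCofree

section Twist

variable (W : WeierstrassCurve ℚ) [W.IsElliptic] (p : ℕ) [hp : Fact p.Prime]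
  {v : HeightOneSpectrum (𝓞 ℚ)}

set_option maxHeartbeats 800000 in
omit [W.IsElliptic] in
/-- **The minimal model of a good ordinary twist is a good model with an ordinary point.** Let
`V/ℚ` be globally minimal with good ordinary reduction at `p` (`GoodOrd V p`: `p ∤ Δ_V`, `p ∤ a_p`),
`d ≠ 0`, and `W = C • V^{(d)}`. At `v ∋ p`, with `w` the spectral valuation of `K̄_v` and
`W₀ = V_ℤ ⊗ 𝒪_w` (unit discriminant, `isUnit_Δ_localIntModel`): over `K̄_v ∋ θ`, `θ² = d`,
`V^{(d)} ⊗ K̄_v = C_θ • V ⊗ K̄_v` (`exists_variableChange_smul_eq_quadraticTwist_sq`,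
`map_quadraticTwist`), so `C' • (W ⊗ ℚ_v) ⊗ K̄_v = W₀ ⊗ K̄_v` with `C' = (C ⊗ K̄_v · C_θ)⁻¹`
(`baseChange_smul_eq`, `localIntModel_baseChange`); and some `p`-torsion point of `W₀(K̄_v)` has
non-zero reduction (`exists_zsmul_eq_zero_localRed_ne_zero` for `V`). This is p05's F-A2 datum
`(C', W₀, hW₀, hΔ)` + `hord` for the `e = 2` rows. [cite: SilvermanAEC2009, X.5 Cor. 5.4 and Thm. V.3.1(a)] -/
theorem exists_goodModel_and_ordinaryPoint_of_goodOrd_twist (hpv : ((p : ℕ) : 𝓞 ℚ) ∈ v.asIdeal)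
    (V : WeierstrassCurve ℚ) [V.IsElliptic] [V.IsGloballyMinimal] {d : ℚ} (hd : d ≠ 0)
    (C : VariableChange ℚ) (hCW : C • V.quadraticTwist d = W) (hV : GoodOrd V p) :
    ∃ (C' : VariableChange (AlgebraicClosure (v.adicCompletion ℚ)))
      (W₀ : WeierstrassCurve (specVal v).integer)
      (_ : C' • (W.baseChange (v.adicCompletion ℚ)).baseChange (AlgebraicClosure (v.adicCompletion ℚ)) =
        W₀.baseChange (AlgebraicClosure (v.adicCompletion ℚ)))
      (hΔ : IsUnit W₀.Δ),
      ∃ P : (W₀.baseChange (AlgebraicClosure (v.adicCompletion ℚ))).toAffine.Point,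
        (p : ℤ) • P = 0 ∧ goodReductionHom W₀ (Valuation.integer.integers (specVal v)) hΔ P ≠ 0 := by
  have hw := specVal_spec (K := ℚ) v
  have hΔV : ¬ (p : ℤ) ∣ minimalDiscriminantInt V :=
    V.not_dvd_minimalDiscriminantInt_of_hasGoodReductionAtPrime' p hV.1
  have hΔu : IsUnit ((integralModelInt V).map (algebraMap ℤ ↥(specVal v).valuationSubring)).Δ :=
    V.isUnit_Δ_localIntModel hpv hw hΔV
  -- the square root of `d` in `K̄_v` and the twisting change of variables
  obtain ⟨θ, hθ⟩ := IsAlgClosed.exists_pow_nat_eq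
    (algebraMap ℚ (AlgebraicClosure (v.adicCompletion ℚ)) d) two_pos
  have hθ0 : θ ≠ 0 := by
    intro h
    rw [h, zero_pow two_ne_zero, eq_comm, map_eq_zero] at hθ
    exact hd hθ
  haveI : (V.baseChange (AlgebraicClosure (v.adicCompletion ℚ))).IsElliptic := by
    rw [baseChange]; infer_instance
  haveI : NeZero (2 : AlgebraicClosure (v.adicCompletion ℚ)) := ⟨by
    rw [← map_ofNat (algebraMap ℚ (AlgebraicClosure (v.adicCompletion ℚ))) 2]
    exact (map_ne_zero _).mpr two_ne_zero⟩
  obtain ⟨Cθ, hCθ⟩ :=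
    (V.baseChange (AlgebraicClosure (v.adicCompletion ℚ))).exists_variableChange_smul_eq_quadraticTwist_sq hθ0
  -- `W ⊗ K̄_v = (C ⊗ K̄_v) • Cθ • (V ⊗ K̄_v)`
  have hWV : (W.baseChange (v.adicCompletion ℚ)).baseChange (AlgebraicClosure (v.adicCompletion ℚ)) =
      (C.baseChange (AlgebraicClosure (v.adicCompletion ℚ)) * Cθ) •
        ((integralModelInt V).map (algebraMap ℤ ↥(specVal v).valuationSubring)).baseChange
          (AlgebraicClosure (v.adicCompletion ℚ)) := by
    rw [baseChange_baseChange_adicCompletion W v, ← hCW, VariableChange.baseChange_smul_eq, mul_smul,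
      localIntModel_baseChange V (specVal v).valuationSubring, hCθ, hθ]
    congr 1
    exact map_quadraticTwist V (algebraMap ℚ (AlgebraicClosure (v.adicCompletion ℚ))) d
  refine ⟨(C.baseChange (AlgebraicClosure (v.adicCompletion ℚ)) * Cθ)⁻¹,
    (integralModelInt V).map (algebraMap ℤ ↥(specVal v).valuationSubring), ?_, hΔu, ?_⟩
  · rw [hWV, inv_smul_smul]
    rfl
  · -- the ordinary point of `V`
    let red₀ : localPoints V (v.adicCompletion ℚ) →+
        (((integralModelInt V).map (algebraMap ℤ ↥(specVal v).valuationSubring)).map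
          (IsLocalRing.residue ↥(specVal v).valuationSubring)).toAffine.Point :=
      (goodReductionHom _ (Valuation.valuationSubring.integers (specVal v)) hΔu).comp
        (Affine.Point.congrEquiv (localIntModel_baseChange V (specVal v).valuationSubring).symm).toAddMonoidHom
    have hred₀ : ∀ P : localPoints V (v.adicCompletion ℚ), red₀ P =
        ((integralModelInt V).map (algebraMap ℤ ↥(specVal v).valuationSubring)).reducePoint
          (Affine.Point.congrEquiv (localIntModel_baseChange V (specVal v).valuationSubring).symm P) :=
      fun P ↦ rfl
    obtain ⟨P, hpP, hP⟩ := V.exists_zsmul_eq_zero_localRed_ne_zero hw hΔu red₀ hred₀ hpv hΔV hV.2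
    refine ⟨Affine.Point.congrEquiv (localIntModel_baseChange V (specVal v).valuationSubring).symm P,
      ?_, hP⟩
    have h := map_zsmul (Affine.Point.congrEquiv
      (localIntModel_baseChange V (specVal v).valuationSubring).symm) (p : ℤ) P
    rw [hpP, map_zero] at h
    exact h.symm

/-- **T-T3B END on the `e = 2` rows: `W = C • V^{(d)}` with `V` good ordinary at `p`, `W` additive at
`v ∋ p`, `p` odd ⟹ `W.localTowerKerPrimary κ (v.adicCompletion ℚ) 0 = ⊥`** for every
`ℤ_p`-extension `κ` (F5 `localTowerKerPrimary_zero_eq_bot_of_goodModel` on the good model of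
`exists_goodModel_and_ordinaryPoint_of_goodOrd_twist`, F4 inputs by p07's
`GoodModelKernelRationalPoints`, `hmove` by F6a). [cite: GreenbergLNM1716, §3 Lemma 3.4 (p. 89) and Prop. 3.8 (p. 95)] -/
theorem localTowerKerPrimary_zero_eq_bot_of_goodOrd_twist (hpv : ((p : ℕ) : 𝓞 ℚ) ∈ v.asIdeal)
    (hp2 : p ≠ 2) (V : WeierstrassCurve ℚ) [V.IsElliptic] [V.IsGloballyMinimal] {d : ℚ} (hd : d ≠ 0)
    (C : VariableChange ℚ) (hCW : C • V.quadraticTwist d = W) (hV : GoodOrd V p)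
    (hadd : W.HasAdditiveReductionAt v) (κ : ZpExtension ℚ p) :
    W.localTowerKerPrimary κ (v.adicCompletion ℚ) 0 = ⊥ := by
  obtain ⟨C', W₀, hW₀, hΔ, hord⟩ :=
    exists_goodModel_and_ordinaryPoint_of_goodOrd_twist W p hpv V hd C hCW hV
  let Φ₁ : localPoints W (v.adicCompletion ℚ) ≃+
      ((W.baseChange (v.adicCompletion ℚ)).baseChange (AlgebraicClosure (v.adicCompletion ℚ))).toAffine.Point :=
    Affine.Point.congrEquiv (baseChange_baseChange_adicCompletion W v).symm
  let Φ : localPoints W (v.adicCompletion ℚ) ≃+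
      (W₀.baseChange (AlgebraicClosure (v.adicCompletion ℚ))).toAffine.Point :=
    (Φ₁.trans (VariableChange.pointEquiv _ C')).trans (Affine.Point.congrEquiv hW₀)
  let red : localPoints W (v.adicCompletion ℚ) →+
      (W₀.map (IsLocalRing.residue (specVal v).integer)).toAffine.Point :=
    (goodReductionHom W₀ (Valuation.integer.integers (specVal v)) hΔ).comp Φ.toAddMonoidHom
  have hred : ∀ P, red P = goodReductionHom W₀ (Valuation.integer.integers (specVal v)) hΔ
      (Affine.Point.congrEquiv hW₀ (VariableChange.pointEquiv _ C'
        (Affine.Point.congrEquiv (baseChange_baseChange_adicCompletion W v).symm P))) := fun _ ↦ rfl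
  exact localTowerKerPrimary_zero_eq_bot_of_goodModel_of_hasAdditiveReductionAt W p hW₀ hΔ red hred
    hpv hp2 hord hadd κ

end Twist

/-! ## The class corollaries: every odd `p`, no defect binder -/

section Classes

variable {W : WeierstrassCurve ℚ} [W.IsGloballyMinimal] [W.IsElliptic] {p : ℕ} [hp : Fact p.Prime]
  {v : HeightOneSpectrum (𝓞 ℚ)}

/-- **X4♯(G-ord) ∩ `I₀*` (`e = 2`), `p` odd: `W.localTowerKerPrimary κ ℚ_v 0 = ⊥`** via the
`p*`-twist good model (`ClassX4Gord.exists_goodOrd_pStar_twist_model`). Nothing booked.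
[cite: GreenbergLNM1716, §3 Lemma 3.4 (p. 89) and Prop. 3.8 (p. 95)] -/
theorem ClassX4Gord.localTowerKerPrimary_zero_eq_bot_of_semistabilityIndex_eq_two
    (hX : ClassX4Gord W p) (he : semistabilityIndex W p = 2)
    (hpv : ((p : ℕ) : 𝓞 ℚ) ∈ v.asIdeal) (κ : ZpExtension ℚ p) :
    W.localTowerKerPrimary κ (v.adicCompletion ℚ) 0 = ⊥ := by
  obtain ⟨V, _, _, C, hV, hC⟩ := ClassX4Gord.exists_goodOrd_pStar_twist_model W p hX he
  have hd : ((-1 : ℚ) ^ (p / 2) * p) ≠ 0 :=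
    mul_ne_zero (pow_ne_zero _ (by norm_num)) (Nat.cast_ne_zero.mpr hp.out.ne_zero)
  have haddv : W.HasAdditiveReductionAt v := by
    rw [eq_primesEquiv_symm p hpv]
    exact hasAdditiveReductionAt_of_addv W p hX.addv.2
  exact localTowerKerPrimary_zero_eq_bot_of_goodOrd_twist W p hpv hX.addv.1 V hd C hC hV haddv κ

/-- **X3♯(G-ord) ∩ `I₀*` (`e = 2`), `p` odd: `W.localTowerKerPrimary κ ℚ_v 0 = ⊥`.** Nothing booked.
[cite: GreenbergLNM1716, §3 Lemma 3.4 (p. 89) and Prop. 3.8 (p. 95)] -/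
theorem ClassX3Gord.localTowerKerPrimary_zero_eq_bot_of_semistabilityIndex_eq_two (hp2 : p ≠ 2)
    (hX : ClassX3Gord W p) (he : semistabilityIndex W p = 2)
    (hpv : ((p : ℕ) : 𝓞 ℚ) ∈ v.asIdeal) (κ : ZpExtension ℚ p) :
    W.localTowerKerPrimary κ (v.adicCompletion ℚ) 0 = ⊥ := by
  obtain ⟨V, _, _, C, hV, hC⟩ := ClassX3Gord.exists_goodOrd_pStar_twist_model W p hp2 hX he
  have hd : ((-1 : ℚ) ^ (p / 2) * p) ≠ 0 :=
    mul_ne_zero (pow_ne_zero _ (by norm_num)) (Nat.cast_ne_zero.mpr hp.out.ne_zero)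
  have haddv : W.HasAdditiveReductionAt v := by
    rw [eq_primesEquiv_symm p hpv]
    exact hasAdditiveReductionAt_of_addv W p hX.addv
  exact localTowerKerPrimary_zero_eq_bot_of_goodOrd_twist W p hpv hp2 V hd C hC hV haddv κ

/-- **X4♯(G-ord) at EVERY odd prime, NO defect binder: `W.localTowerKerPrimary κ (v.adicCompletion ℚ) 0 = ⊥`
for every `ℤ_p`-extension `κ`** — the `v ∣ p` socket `hp0 κ v` of p06's
`mu_anchor_of_card_selmer_eq_one_of_additive_away` on ALL X4♯(G-ord) partners. `p = 3` forces
`e = 2` (`semistabilityIndex_eq_two_of_typeG_three`); at `p ≥ 5`, `e = 2` by the twist good model,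
`e ∈ {3,4,6}` by F6. X4♯(G-ord) stays CONSTRUCTION-SHAPED; nothing booked.
[cite: GreenbergLNM1716, §3 Lemma 3.4 (p. 89) and Prop. 3.8 (p. 95)] -/
theorem ClassX4Gord.localTowerKerPrimary_zero_eq_bot (hX : ClassX4Gord W p)
    (hpv : ((p : ℕ) : 𝓞 ℚ) ∈ v.asIdeal) (κ : ZpExtension ℚ p) :
    W.localTowerKerPrimary κ (v.adicCompletion ℚ) 0 = ⊥ := by
  have hp2 : p ≠ 2 := hX.addv.1
  by_cases hp3 : p = 3
  · subst hp3
    exact ClassX4Gord.localTowerKerPrimary_zero_eq_bot_of_semistabilityIndex_eq_two hX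
      (semistabilityIndex_eq_two_of_typeG_three W hX.typeGOrd.typeG hX.addv.2) hpv κ
  · have hp5 : 5 ≤ p := by
      have h2 := hp.out.two_le
      rcases Nat.lt_or_ge p 5 with h | h
      · interval_cases p
        · exact absurd rfl hp2
        · exact absurd rfl hp3
        · exact absurd hp.out (by decide)
      · exact h
    by_cases he : semistabilityIndex W p = 2
    · exact ClassX4Gord.localTowerKerPrimary_zero_eq_bot_of_semistabilityIndex_eq_two hX he hpv κ
    · exact ClassX4Gord.localTowerKerPrimary_zero_eq_bot_of_five_le_of_semistabilityIndex_ne_two hX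
        hp5 he hpv κ

/-- **X3♯(G-ord) at EVERY odd prime, NO defect binder: `W.localTowerKerPrimary κ ℚ_v 0 = ⊥`.**
X3♯(G-ord) stays as labelled; nothing booked.
[cite: GreenbergLNM1716, §3 Lemma 3.4 (p. 89) and Prop. 3.8 (p. 95)] -/
theorem ClassX3Gord.localTowerKerPrimary_zero_eq_bot (hp2 : p ≠ 2) (hX : ClassX3Gord W p)
    (hpv : ((p : ℕ) : 𝓞 ℚ) ∈ v.asIdeal) (κ : ZpExtension ℚ p) :
    W.localTowerKerPrimary κ (v.adicCompletion ℚ) 0 = ⊥ := by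
  by_cases hp3 : p = 3
  · subst hp3
    exact ClassX3Gord.localTowerKerPrimary_zero_eq_bot_of_semistabilityIndex_eq_two hp2 hX
      (semistabilityIndex_eq_two_of_typeG_three W hX.typeGOrd.typeG hX.addv) hpv κ
  · have hp5 : 5 ≤ p := by
      have h2 := hp.out.two_le
      rcases Nat.lt_or_ge p 5 with h | h
      · interval_cases p
        · exact absurd rfl hp2
        · exact absurd rfl hp3
        · exact absurd hp.out (by decide)
      · exact h
    by_cases he : semistabilityIndex W p = 2
    · exact ClassX3Gord.localTowerKerPrimary_zero_eq_bot_of_semistabilityIndex_eq_two hp2 hX he hpv κ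
    · exact ClassX3Gord.localTowerKerPrimary_zero_eq_bot_of_five_le_of_semistabilityIndex_ne_two hX
        hp5 he hpv κ

end Classes

end Summit.BirchSwinnertonDyer.Rank1Residual.Additive.GoodModelLine

end
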